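import Summits.BirchSwinnertonDyer.BirchSwinnertonDyer.Theorems.PrintX8VerticalStevensGamma1Terms
import HarnessLib

/-!
# Route `PrintX8`, cruxes 20622 / 20714 — LINES «vertical Stevens at 3» and «layered Stevens at 3»:
# the GENERIC BRIDGE `BridgeBy` (planner turnkey LS-B) — span mod `p` by a test set `S` up to Eisenstein
# + `a_p ≢ 1 (mod p)` ⟹ some `γ ∈ S` has `[γ·0]⁺_f ≢ [0]⁺_f (mod p)`; one layer ⟹ a unit symbol in that layer

Cell `bsd-print-x8`, seat p1 (gen 4), `--supports stmt-BirchSwinnertonDyer-20622`.  Theorems only; no named-fact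
hypothesis (all analytic inputs are tree theorems, as in `PrintX8VerticalStevensBridge`).

## Statement (`plan/ls/SketchLS.lean` `LS.BridgeBy`, generic form asked of this seat)

For a normalised rational newform `f ∈ S₂(Γ₀(N))`, an odd prime `p ∤ N` with `a_p(f) ≢ 1 (mod p)`, and a test set
`S ⊆ Γ₀(N)` with `SpanModBy N p S` (ty2 p561961: `Γ₁(N) ⊆ ⟨S ∪ finite-order ∪ trace ±2 ∪ p-th powers⟩·[Γ₀,Γ₀]`),
SOME `γ = (a b; c d) ∈ S` has `1 ≤ ‖[b/d]⁺_f − [0]⁺_f‖_p` (`exists_mem_one_le_norm_sub_of_spanModBy`).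
Instances: `S` = all good elements (VS-B, `PrintX8VerticalStevensBridge.exists_one_le_norm_sub_of_spanMod`) and
`S = goodLayer N p k` (LS-B: `LayerEisSpanModGen N p k`, `k ≥ 1` ⟹ a UNIT symbol `[b/pᵏ]⁺ − [0]⁺`, `p ∤ b`, IN THE
LAYER `k`: `exists_one_le_norm_layer_of_layerEisSpanModGen`).  Curve forms: `PrintX8LayeredStevensBridge.lean`.

## Difference with VS-B

Only `Γ₁(N)`-invariance of the reduced period functional `m̄ : Γ₀(N) → ℤ/p` is available (not `Γ_H(N)`), i.e. `m̄`
is an additive character of `d mod N` with no information at `p`.  The Hecke step still closes: at `x = γ∞ = a/c`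
the `p + 1` terms of (4.2) are `[δ∞]⁺` with `d(δγ⁻¹) ≡ 1` for the generic `j`, `≡ p` for the one `j₀` with
`p ∣ a + j₀c`, and `≡ p^{φ(N)−1} = p⁻¹` for `pa/c` (if `p ∣ c`: all `≡ 1`); the two exceptional contributions
cancel (`(δ_{j₀}γ⁻¹)(δ'γ⁻¹) ∈ Γ₁(N)`), so `Σ terms = (p+1)·m̄(γ) = m̄(γ)` and `(a_p − 1)·m̄(γ) = 0` as before.
-/

-- the summit namespace repeats `BirchSwinnertonDyer` by design (summit = problem); linter moot
set_option linter.dupNamespace false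
set_option autoImplicit false

noncomputable section

namespace Summit.BirchSwinnertonDyer.BirchSwinnertonDyer.Theorems.PrintX8VerticalStevens

open scoped MatrixGroups ModularForm

open CongruenceSubgroup Matrix Matrix.SpecialLinearGroup
  Literature.NumberTheory.EllipticCurves Literature.NumberTheory.EllipticCurves.ModularForms
  Literature.NumberTheory.EllipticCurves.Rank1Residual

section GenericBridge

variable {N : ℕ} [NeZero N] {f : CuspForm (Gamma0 N) 2} {p : ℕ} [Fact p.Prime]

/-- **THE GENERIC BRIDGE `BridgeBy` (level form; planner turnkey LS-B).**  For a normalised newform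
`f ∈ S₂(Γ₀(N))` with rational coefficients, an odd prime `p ∤ N` with `a_p(f) ≢ 1 (mod p)`, and ANY test set
`S ⊆ Γ₀(N)` with `SpanModBy N p S` (`Γ₁(N) ⊆ ⟨S ∪ finite-order ∪ trace ±2 ∪ p-th powers⟩·[Γ₀(N), Γ₀(N)]`), some
`γ = (a b; c d) ∈ S` has `1 ≤ ‖[b/d]⁺_f − [0]⁺_f‖_p`.  (Memo `plan/ls/LINE-LAYERED-STEVENS-AT-3.md`; `SketchLS`
`LS.BridgeBy`.)  No hypothesis on the image of `ρ̄_f`; no named fact. -/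
theorem exists_mem_one_le_norm_sub_of_spanModBy (hf : IsNewform0 f) (hQ : coeffField f = ⊥)
    (hp2 : p ≠ 2) (hpN : ¬ p ∣ N) {ap : ℤ} (hap : cuspCoeff f p = ap) (hap1 : ¬ (p : ℤ) ∣ ap - 1)
    (S : Set (Gamma0 N)) (hS : SpanModBy N p S) :
    ∃ γ ∈ S, 1 ≤ ‖((ratPlusSymbol f ((((γ : SL(2, ℤ)) 0 1 : ℤ) : ℚ) / (((γ : SL(2, ℤ)) 1 1 : ℤ) : ℚ)) -
        ratPlusSymbol f 0 : ℚ) : ℚ_[p])‖ := by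
  have hp : p.Prime := Fact.out
  have hreal : ∀ n, (cuspCoeff f n).im = 0 := cuspCoeff_im_eq_zero_of_coeffField_eq_bot hQ
  have hrat : ∀ r : ℚ, (ratPlusSymbol f r : ℝ) = normalizedPlusSymbol f r :=
    fun r ↦ ratCast_ratPlusSymbol_holds hf hQ r
  have hΩpos : 0 < plusPeriod f := (plusPeriod_pos_and_realPeriods_eq isZLattice_periodLattice_holds hf hQ).1
  have hΩ : plusPeriod f ≠ 0 := hΩpos.ne'
  have hΩ2 : plusPeriod f / 2 ≠ 0 := div_ne_zero hΩ two_ne_zero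
  obtain ⟨hre, -⟩ := realPeriods_eq_zmultiples_of_plusPeriod_ne_zero f hΩ
  -- the integer-valued period functional `m`: `re{∞, γ∞} = m(γ)·Ω⁺/2`
  choose m hm using exists_re_cuspSymbol_eq f hre
  have hm_zero : ∀ γ, cuspSymbol f γ = 0 → m γ = 0 := by
    intro γ h0
    have h := hm γ
    rw [h0, Complex.zero_re] at h
    exact_mod_cast (mul_eq_zero.mp h.symm).resolve_right hΩ2
  have hm_mul : ∀ γ δ, m (γ * δ) = m γ + m δ := by
    intro γ δ
    have h2 : (cuspSymbol f (γ * δ)).re = (cuspSymbol f γ).re + (cuspSymbol f δ).re := by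
      rw [cuspSymbol_mul_holds f γ δ, Complex.add_re]
    rw [hm, hm, hm, ← add_mul] at h2
    exact_mod_cast mul_right_cancel₀ hΩ2 h2
  have hm_one : m 1 = 0 := hm_zero 1 (cuspSymbol_one f)
  have hm_inv : ∀ γ, m γ⁻¹ = -m γ := by
    intro γ
    have h := hm_mul γ γ⁻¹
    rw [mul_inv_cancel, hm_one] at h
    linarith
  have hm_pow : ∀ (γ : Gamma0 N) (n : ℕ), m (γ ^ n) = n * m γ := by
    intro γ n
    induction n with
    | zero => simp [hm_one]
    | succ n ih => rw [pow_succ, hm_mul, ih]; push_cast; ring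
  -- symbol identities, in `ℚ`
  have hsub : ∀ (γ : Gamma0 N) (r : ℚ),
      ((γ : SL(2, ℤ)) 1 0 : ℚ) * r + ((γ : SL(2, ℤ)) 1 1 : ℚ) ≠ 0 →
      ratPlusSymbol f
          ((((γ : SL(2, ℤ)) 0 0 : ℚ) * r + ((γ : SL(2, ℤ)) 0 1 : ℚ)) /
            (((γ : SL(2, ℤ)) 1 0 : ℚ) * r + ((γ : SL(2, ℤ)) 1 1 : ℚ))) -
        ratPlusSymbol f r = (m γ : ℚ) / 2 := by
    intro γ r hr
    have h := ratCast_ratPlusSymbol_moebius_sub f hrat hreal γ r hr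
    rw [hm] at h
    have h' : (((ratPlusSymbol f
          ((((γ : SL(2, ℤ)) 0 0 : ℚ) * r + ((γ : SL(2, ℤ)) 0 1 : ℚ)) /
            (((γ : SL(2, ℤ)) 1 0 : ℚ) * r + ((γ : SL(2, ℤ)) 1 1 : ℚ))) -
        ratPlusSymbol f r : ℚ)) : ℝ) = (((m γ : ℚ) / 2 : ℚ) : ℝ) := by
      push_cast
      rw [h]
      field_simp
    exact_mod_cast h'
  have hinf : ∀ γ : Gamma0 N, ((γ : SL(2, ℤ)) 1 0 : ℤ) ≠ 0 →
      ratPlusSymbol f (((γ : SL(2, ℤ)) 0 0 : ℚ) / ((γ : SL(2, ℤ)) 1 0 : ℚ)) = (m γ : ℚ) / 2 := by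
    intro γ hc
    have h := ratCast_ratPlusSymbol_apply_infty f hrat hreal γ hc
    rw [hm] at h
    have h' : ((ratPlusSymbol f (((γ : SL(2, ℤ)) 0 0 : ℚ) / ((γ : SL(2, ℤ)) 1 0 : ℚ)) : ℚ) : ℝ) =
        (((m γ : ℚ) / 2 : ℚ) : ℝ) := by
      rw [h]; push_cast; field_simp
    exact_mod_cast h'
  -- reduction mod `p` as a homomorphism to `ℤ/p` (written multiplicatively)
  let φ : Gamma0 N →* Multiplicative (ZMod p) :=
    { toFun := fun γ ↦ Multiplicative.ofAdd (((m γ : ℤ) : ZMod p))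
      map_one' := by simp [hm_one]
      map_mul' := fun γ δ ↦ by simp [hm_mul, ofAdd_add] }
  have hφ : ∀ γ, φ γ = 1 ↔ (p : ℤ) ∣ m γ := by
    intro γ
    simp [φ, ZMod.intCast_zmod_eq_zero_iff_dvd]
  -- suppose, for contradiction, that every test element has symbol difference of norm `< 1`
  by_contra H
  push Not at H
  -- (1) the test subgroup lies in the kernel
  have hker : Subgroup.closure (S ∪ trivialGens N ∪ pthPowers N p) ⊔ commutator (Gamma0 N) ≤ φ.ker := by
    refine sup_le ?_ (Abelianization.commutator_subset_ker φ)
    rw [Subgroup.closure_le]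
    rintro γ ((hγ | htriv) | ⟨h, rfl⟩)
    · -- test elements: `[γ·0]⁺ − [0]⁺ = m(γ)/2` has norm `< 1`, or `d = 0` (degenerate)
      rw [SetLike.mem_coe, MonoidHom.mem_ker, hφ]
      by_cases hd : ((γ : SL(2, ℤ)) 1 1 : ℤ) = 0
      · exact ⟨0, by rw [hm_zero γ (cuspSymbol_eq_zero_of_apply_one_one_eq_zero f γ hd), mul_zero]⟩
      · have hd0 : ((γ : SL(2, ℤ)) 1 1 : ℚ) ≠ 0 := by exact_mod_cast hd
        have h0 := hsub γ 0 (by simpa using hd0)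
        simp only [mul_zero, zero_add] at h0
        apply dvd_of_norm_div_two_lt_one hp2
        rw [← h0]
        exact H γ hγ
    · rw [SetLike.mem_coe, MonoidHom.mem_ker, hφ]
      rcases htriv with hfin | htr | htr
      · exact ⟨0, by rw [hm_zero γ (cuspSymbol_eq_zero_of_isOfFinOrder f hfin), mul_zero]⟩
      · exact ⟨0, by rw [hm_zero γ (cuspSymbol_eq_zero_of_trEntry f (Or.inl htr)), mul_zero]⟩
      · exact ⟨0, by rw [hm_zero γ (cuspSymbol_eq_zero_of_trEntry f (Or.inr htr)), mul_zero]⟩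
    · -- `p`-th powers
      rw [SetLike.mem_coe, MonoidHom.mem_ker, hφ, hm_pow]
      exact ⟨m h, by ring⟩
  -- (2) hence `m̄` vanishes on `Γ₁(N)` and is constant on `Γ₁(N)`-cosets
  have hΓ₁ : ∀ γ : Gamma0 N, γ ∈ Gamma1' N → ((m γ : ℤ) : ZMod p) = 0 := fun γ hγ ↦
    (ZMod.intCast_zmod_eq_zero_iff_dvd _ _).mpr ((hφ γ).mp (hker (hS γ hγ)))
  have hcoset : ∀ γ δ : Gamma0 N, δ * γ⁻¹ ∈ Gamma1' N →
      ((m δ : ℤ) : ZMod p) = ((m γ : ℤ) : ZMod p) := by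
    intro γ δ h
    have h1 := hΓ₁ _ h
    rw [hm_mul, hm_inv, ← sub_eq_add_neg, Int.cast_sub, sub_eq_zero] at h1
    exact h1
  -- two ratio elements with `d ≡ p` and `d ≡ p^{φ(N)-1}` have cancelling `m̄`-contributions
  have hpair : ∀ γ δ δ' : Gamma0 N, Gamma0Map N (δ * γ⁻¹) = (p : ZMod N) →
      Gamma0Map N (δ' * γ⁻¹) = (p : ZMod N) ^ (Nat.totient N - 1) →
      ((m δ : ℤ) : ZMod p) + ((m δ' : ℤ) : ZMod p) = 2 * ((m γ : ℤ) : ZMod p) := by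
    intro γ δ δ' hδ hδ'
    -- `(δγ⁻¹)(δ'γ⁻¹) ∈ Γ₁(N)` since `p · p^{φ−1} = 1`
    have hprod : δ * γ⁻¹ * (δ' * γ⁻¹) ∈ Gamma1' N := by
      rw [Gamma1_mem', map_mul, hδ, hδ', mul_comm, pow_totient_sub_one_mul_self (N := N) (p := p) hpN]
    have h1 := hΓ₁ _ hprod
    rw [hm_mul, hm_mul, hm_mul, hm_inv] at h1
    push_cast at h1
    linear_combination h1
  -- (3) the Hecke step: `m̄ ≡ 0` on all of `Γ₀(N)`
  have hap1' : ((ap - 1 : ℤ) : ZMod p) ≠ 0 := by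
    rwa [ne_eq, ZMod.intCast_zmod_eq_zero_iff_dvd]
  have hall : ∀ γ : Gamma0 N, (p : ℤ) ∣ m γ := by
    intro γ
    by_cases hc : ((γ : SL(2, ℤ)) 1 0 : ℤ) = 0
    · have h0 : cuspSymbol f γ = 0 := by simp [cuspSymbol, hc]
      rw [hm_zero γ h0]; exact dvd_zero _
    · have hHecke := intCast_mul_ratPlusSymbol p hf hp hpN hap hrat
        (((γ : SL(2, ℤ)) 0 0 : ℚ) / ((γ : SL(2, ℤ)) 1 0 : ℚ))
      have hterm := fun j : Fin p ↦ exists_heckeTerm_gamma1 (N := N) (p := p) γ hc ((j : ℕ) : ℤ)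
      choose δ hδ0 hδq hδ1 hδp using hterm
      obtain ⟨δ', hδ'0, hδ'q, hδ'1, hδ'p⟩ := exists_heckeTerm'_gamma1 (N := N) (p := p) hpN γ hc
      have hcQ : (((γ : SL(2, ℤ)) 1 0 : ℤ) : ℚ) ≠ 0 := by exact_mod_cast hc
      have hpQ : (p : ℚ) ≠ 0 := by exact_mod_cast hp.ne_zero
      have e0 := hinf γ hc
      have ej : ∀ j : Fin p,
          ratPlusSymbol f ((((γ : SL(2, ℤ)) 0 0 : ℚ) / ((γ : SL(2, ℤ)) 1 0 : ℚ) + j) / p) =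
            (m (δ j) : ℚ) / 2 := by
        intro j
        rw [← hinf (δ j) (hδ0 j), hδq j]
        congr 1
        push_cast
        field_simp
      have e' : ratPlusSymbol f (p * ((((γ : SL(2, ℤ)) 0 0 : ℚ) / ((γ : SL(2, ℤ)) 1 0 : ℚ)))) =
          (m δ' : ℚ) / 2 := by
        rw [← hinf δ' hδ'0, hδ'q]
      rw [e0, e'] at hHecke
      simp_rw [ej] at hHecke
      -- `ap · m γ = Σ m(δ j) + m δ'` in `ℤ`
      have hZ : ((ap * m γ : ℤ) : ℚ) = ((∑ j : Fin p, m (δ j) + m δ' : ℤ) : ℚ) := by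
        push_cast
        have := hHecke
        rw [← Finset.sum_div] at this
        linear_combination 2 * this
      have hZ' : ap * m γ = ∑ j : Fin p, m (δ j) + m δ' := by exact_mod_cast hZ
      have hmod : ((ap : ℤ) : ZMod p) * ((m γ : ℤ) : ZMod p) =
          ∑ j : Fin p, ((m (δ j) : ℤ) : ZMod p) + ((m δ' : ℤ) : ZMod p) := by
        have := congrArg (Int.cast : ℤ → ZMod p) hZ'
        push_cast at this
        exact this
      -- the sum of the `p + 1` reduced terms is `(p + 1)·m̄(γ) = m̄(γ)`
      have hsum : ∑ j : Fin p, ((m (δ j) : ℤ) : ZMod p) + ((m δ' : ℤ) : ZMod p) =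
          ((m γ : ℤ) : ZMod p) := by
        -- notation
        have hdet : ((γ : SL(2, ℤ)) 0 0 : ℤ) * ((γ : SL(2, ℤ)) 1 1 : ℤ) -
            ((γ : SL(2, ℤ)) 0 1 : ℤ) * ((γ : SL(2, ℤ)) 1 0 : ℤ) = 1 := by
          have := Matrix.SpecialLinearGroup.det_coe (γ : SL(2, ℤ))
          rw [Matrix.det_fin_two] at this
          linear_combination this
        have hpZ : Prime (p : ℤ) := Nat.prime_iff_prime_int.mp hp
        -- every term congruent to `m̄ γ` sums to `p • m̄ γ = 0` over `Fin p`
        have hconst : ∑ _j : Fin p, ((m γ : ℤ) : ZMod p) = 0 := by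
          rw [Finset.sum_const, Finset.card_univ, Fintype.card_fin, nsmul_eq_mul, ZMod.natCast_self,
            zero_mul]
        by_cases hpc : (p : ℤ) ∣ ((γ : SL(2, ℤ)) 1 0 : ℤ)
        · -- all `p + 1` ratio elements lie in `Γ₁(N)`
          have hpa : ¬ (p : ℤ) ∣ ((γ : SL(2, ℤ)) 0 0 : ℤ) := by
            intro hpa
            have : (p : ℤ) ∣ 1 := by
              rw [← hdet]
              exact dvd_sub (hpa.mul_right _) (hpc.mul_left _)
            exact hpZ.not_dvd_one this
          have hgen : ∀ j : Fin p,
              ¬ (p : ℤ) ∣ ((γ : SL(2, ℤ)) 0 0 : ℤ) + ((j : ℕ) : ℤ) * ((γ : SL(2, ℤ)) 1 0 : ℤ) := by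
            intro j hdiv
            have h := dvd_sub hdiv (hpc.mul_left ((j : ℕ) : ℤ))
            rw [add_sub_cancel_right] at h
            exact hpa h
          have hj : ∀ j : Fin p, ((m (δ j) : ℤ) : ZMod p) = ((m γ : ℤ) : ZMod p) :=
            fun j ↦ hcoset γ (δ j) (hδ1 j (hgen j))
          have h' : ((m δ' : ℤ) : ZMod p) = ((m γ : ℤ) : ZMod p) := hcoset γ δ' (hδ'1 hpc)
          simp_rw [hj, h', hconst, zero_add]
        · -- exactly one special index `j₀` (with `p ∣ a + j₀ c`); it pairs with the `pa/c` term
          have hcp : ((((γ : SL(2, ℤ)) 1 0 : ℤ)) : ZMod p) ≠ 0 := by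
            rwa [ne_eq, ZMod.intCast_zmod_eq_zero_iff_dvd]
          set z : ZMod p := -((((γ : SL(2, ℤ)) 0 0 : ℤ)) : ZMod p) * ((((γ : SL(2, ℤ)) 1 0 : ℤ)) : ZMod p)⁻¹
            with hz
          set j₀ : Fin p := ⟨z.val, z.val_lt⟩ with hj₀
          have hj₀z : (((j₀ : ℕ) : ℤ) : ZMod p) = z := by
            rw [hj₀]; push_cast; exact ZMod.natCast_zmod_val z
          -- characterisation of the special index
          have hspec : ∀ j : Fin p,
              (p : ℤ) ∣ ((γ : SL(2, ℤ)) 0 0 : ℤ) + ((j : ℕ) : ℤ) * ((γ : SL(2, ℤ)) 1 0 : ℤ) ↔ j = j₀ := by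
            intro j
            rw [← ZMod.intCast_zmod_eq_zero_iff_dvd]
            push_cast
            constructor
            · intro h
              have hjz : ((j : ℕ) : ZMod p) = z := by
                rw [hz, eq_mul_inv_iff_mul_eq₀ hcp]
                linear_combination h
              have hj₀z' : ((j₀ : ℕ) : ZMod p) = z := by exact_mod_cast hj₀z
              apply Fin.ext
              have h1 : ((j : ℕ) : ZMod p) = ((j₀ : ℕ) : ZMod p) := hjz.trans hj₀z'.symm
              have h2 := congrArg ZMod.val h1
              rwa [ZMod.val_natCast, ZMod.val_natCast, Nat.mod_eq_of_lt j.isLt,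
                Nat.mod_eq_of_lt j₀.isLt] at h2
            · rintro rfl
              have : (((j₀ : ℕ) : ℤ) : ZMod p) = z := hj₀z
              push_cast at this
              rw [this, hz]
              field_simp
              ring
          have hj : ∀ j : Fin p, j ≠ j₀ → ((m (δ j) : ℤ) : ZMod p) = ((m γ : ℤ) : ZMod p) :=
            fun j hne ↦ hcoset γ (δ j) (hδ1 j (fun h ↦ hne ((hspec j).mp h)))
          have hj₀p : Gamma0Map N (δ j₀ * γ⁻¹) = (p : ZMod N) := hδp j₀ ((hspec j₀).mpr rfl)
          have hpair' := hpair γ (δ j₀) δ' hj₀p (hδ'p hpc)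
          -- split the sum at `j₀`
          have hsplit : ∑ j : Fin p, ((m (δ j) : ℤ) : ZMod p) =
              ∑ _j : Fin p, ((m γ : ℤ) : ZMod p) +
                (((m (δ j₀) : ℤ) : ZMod p) - ((m γ : ℤ) : ZMod p)) := by
            have h1 : ∑ j : Fin p, ((m (δ j) : ℤ) : ZMod p) =
                ∑ j : Fin p, (((m γ : ℤ) : ZMod p) + (((m (δ j) : ℤ) : ZMod p) - ((m γ : ℤ) : ZMod p))) :=
              Finset.sum_congr rfl fun j _ ↦ by ring
            have h2 : ∑ j : Fin p, (((m (δ j) : ℤ) : ZMod p) - ((m γ : ℤ) : ZMod p)) =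
                ((m (δ j₀) : ℤ) : ZMod p) - ((m γ : ℤ) : ZMod p) :=
              Finset.sum_eq_single_of_mem j₀ (Finset.mem_univ _)
                fun j _ hne ↦ by rw [hj j hne, sub_self]
            rw [h1, Finset.sum_add_distrib, h2]
          rw [hsplit, hconst, zero_add]
          linear_combination hpair'
      rw [hsum] at hmod
      have hzero : ((ap - 1 : ℤ) : ZMod p) * ((m γ : ℤ) : ZMod p) = 0 := by
        push_cast; linear_combination hmod
      rw [← ZMod.intCast_zmod_eq_zero_iff_dvd]
      exact (mul_eq_zero.mp hzero).resolve_left hap1'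
  -- (4) contradiction with the primitivity of the period functional
  exact not_forall_dvd_of_realPeriods f hre hΩ hp.one_lt hm hall

end GenericBridge

section Layers

variable {N : ℕ} [NeZero N] {f : CuspForm (Gamma0 N) 2} {p : ℕ} [Fact p.Prime]

/-- **LS-B, level form** (one layer): `LayerEisSpanModGen N p k` with `k ≥ 1`, `p` odd, `p ∤ N`,
`a_p(f) ≢ 1 (mod p)` ⟹ a UNIT plus symbol in the layer `k`: `1 ≤ ‖[b/pᵏ]⁺_f − [0]⁺_f‖_p` for some `b` with
`p ∤ b` (the generic bridge at the test set `goodLayer N p k`; `γ·0 = b/±pᵏ` in lowest terms). -/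
theorem exists_one_le_norm_layer_of_layerEisSpanModGen (hf : IsNewform0 f) (hQ : coeffField f = ⊥)
    (hp2 : p ≠ 2) (hpN : ¬ p ∣ N) {ap : ℤ} (hap : cuspCoeff f p = ap) (hap1 : ¬ (p : ℤ) ∣ ap - 1)
    {k : ℕ} (hk : 1 ≤ k) (hL : LayerEisSpanModGen N p k) :
    ∃ b : ℤ, ¬ (p : ℤ) ∣ b ∧
      1 ≤ ‖((ratPlusSymbol f ((b : ℚ) / (p : ℚ) ^ k) - ratPlusSymbol f 0 : ℚ) : ℚ_[p])‖ := by
  have hp : p.Prime := Fact.out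
  obtain ⟨γ, hγ, hunit⟩ := exists_mem_one_le_norm_sub_of_spanModBy hf hQ hp2 hpN hap hap1
    (goodLayer N p k) ((spanModBy_goodLayer_iff N p k).mpr hL)
  have hd : ((γ : SL(2, ℤ)) 1 1 : ℤ) = (p : ℤ) ^ k ∨ ((γ : SL(2, ℤ)) 1 1 : ℤ) = -((p : ℤ) ^ k) := by
    have := Int.natAbs_eq_iff.mp hγ
    push_cast at this
    simpa [dEntry] using this
  have hdet : ((γ : SL(2, ℤ)) 0 0 : ℤ) * ((γ : SL(2, ℤ)) 1 1 : ℤ) -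
      ((γ : SL(2, ℤ)) 0 1 : ℤ) * ((γ : SL(2, ℤ)) 1 0 : ℤ) = 1 := by
    have := Matrix.SpecialLinearGroup.det_coe (γ : SL(2, ℤ))
    rw [Matrix.det_fin_two] at this
    linear_combination this
  have hpZ : Prime (p : ℤ) := Nat.prime_iff_prime_int.mp hp
  -- `p ∣ d` (`k ≥ 1`), hence `p ∤ b`
  have hpd : (p : ℤ) ∣ ((γ : SL(2, ℤ)) 1 1 : ℤ) := by
    have hpk : (p : ℤ) ∣ (p : ℤ) ^ k := dvd_pow_self _ (by omega)
    rcases hd with hd | hd <;> rw [hd]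
    · exact hpk
    · exact hpk.neg_right
  have hpb : ¬ (p : ℤ) ∣ ((γ : SL(2, ℤ)) 0 1 : ℤ) := by
    intro hpb
    have : (p : ℤ) ∣ 1 := by
      rw [← hdet]
      exact dvd_sub (hpd.mul_left _) (hpb.mul_right _)
    exact hpZ.not_dvd_one this
  rcases hd with hd | hd
  · refine ⟨((γ : SL(2, ℤ)) 0 1 : ℤ), hpb, ?_⟩
    have e : (((γ : SL(2, ℤ)) 0 1 : ℤ) : ℚ) / (p : ℚ) ^ k =
        (((γ : SL(2, ℤ)) 0 1 : ℤ) : ℚ) / (((γ : SL(2, ℤ)) 1 1 : ℤ) : ℚ) := by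
      rw [hd]; push_cast; rfl
    rw [e]; exact hunit
  · refine ⟨-((γ : SL(2, ℤ)) 0 1 : ℤ), fun h ↦ hpb (dvd_neg.mp h), ?_⟩
    have e : (((-((γ : SL(2, ℤ)) 0 1 : ℤ) : ℤ)) : ℚ) / (p : ℚ) ^ k =
        (((γ : SL(2, ℤ)) 0 1 : ℤ) : ℚ) / (((γ : SL(2, ℤ)) 1 1 : ℤ) : ℚ) := by
      rw [hd]; push_cast; rw [div_neg, neg_div]
    rw [e]; exact hunit

end Layers

end Summit.BirchSwinnertonDyer.BirchSwinnertonDyer.Theorems.PrintX8VerticalStevens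

end
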